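import Summits.KontsevichZagierPeriods.KontsevichZagierPeriods.Theses.FurushoPentagon
import Summits.KontsevichZagierPeriods.KontsevichZagierPeriods.Theorems.FurushoPentagonReducedPeriodRingLinStokesSymDefs
import Summits.KontsevichZagierPeriods.KontsevichZagierPeriods.Theorems.FurushoPentagonReducedPeriodRingSubdivGeneration
import Summits.KontsevichZagierPeriods.KontsevichZagierPeriods.Theorems.FurushoPentagonSectorToKernelStokesSpanCalibration
import Literature.NumberTheory.Transcendental.KZCubicalCalculus
import Literature.NumberTheory.Transcendental.KZProductIdeal
import Literature.NumberTheory.Transcendental.SemialgebraicMapsProofs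
import Literature.NumberTheory.Transcendental.SemialgebraicLineDeriv
import Mathlib.Analysis.Calculus.Deriv.Pi
import Mathlib.Analysis.Calculus.Deriv.Mul
import Mathlib.Analysis.Calculus.Deriv.Comp

/-!
# `ReducedPeriodRing`, line `lin-stokes-sym`: coordinate reflections from StokesLast + Sym

Crux `FurushoPentagon.ReducedPeriodRing` (stmt-KontsevichZagierPeriods-3929), line `lin-stokes-sym`,
stub `stub_reflectionGeneration`: for tame cubes `r, r'` on `[0,1]ⁿ` (domain the closed cube,
integrand analytic near it) related by the reflection of one coordinate,
`r.integrand x = r'.integrand (x with xⱼ ↦ 1 − xⱼ)` on the cube, the element `[r] − [r']` lies in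
Ayoub's relation module with symmetries `linStokesSymIdeal = closure (Lin ∪ StokesLast ∪ Sym)`
(`…ReducedPeriodRingLinStokesSymDefs`). Together with the coordinate permutations (`Sym`) this
puts the whole hyperoctahedral group of the cube in the ideal; it is piece (A) of the cubical
change-of-variables step of the line.

Proof (`ReflectionGeneration.of_sub_of_mem`), a two-coordinate Stokes identity. Write
`g = r'.integrand`, `u = xⱼ`, add a new LAST coordinate `y ∈ [0,1]` and put `φ(u, y) = u(1 − y)`
(so `φ(u, 0) = u`, `φ(u, 1) = 0`, `φ(1, y) = 1 − y`, `φ(0, y) = 0`). The two components of the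
pulled-back 1-form `−g(x with xⱼ ↦ φ) dφ`,
`K = (y − 1)·g(x with xⱼ ↦ u(1 − y))` (notation `K[n, g, j]`) and
`L = u·g(x with xⱼ ↦ u(1 − y))` (notation `L[n, g, j]`), satisfy `∂_y K = ∂ᵤ L`
(both are `g + u(1 − y)·∂ⱼg` at the contracted point), `K|_{y=1} − K|_{y=0} = g(x)` and
`L|_{u=1} − L|_{u=0} = g(x with xⱼ ↦ 1 − y)`. So with `R = [[0,1]ⁿ⁺¹, ∂_y K]` and the
transposition `τ = (j last)`: `[R] − [r']` is Newton–Leibniz along `y` (primitive `K`),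
`[R] − [R.reindex τ]` is a symmetry, and `[R.reindex τ] − [r]` is Newton–Leibniz along the new
last coordinate `u` (primitive `L ∘ τ`, whose boundary difference at `y ↦ xⱼ` is
`g(x with xⱼ ↦ 1 − xⱼ) = r.integrand x`); hence
`[r] − [r'] = ([R] − [r']) − ([R] − [R.reindex τ]) − ([R.reindex τ] − [r])`. Analyticity near the
closed cube and `ℚ`-semialgebraicity on it of `K`, `L`, `L ∘ τ` come from those of `g`
(compositions with polynomial self-maps of the cube over `ℚ`); for `∂_y K` they are
`stokesCal_isSemialgebraicFunOn_fderiv_last` (Basu–Pollack–Roy Prop. 3.22 on the cube with open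
last coordinate, then closure of the graph), exactly as for the subdivision stub
(`…ReducedPeriodRingSubdivGeneration`).

References: J. Ayoub, *Periods and the conjectures of Grothendieck and Kontsevich–Zagier*, EMS
Newsl. 91 (2014), Def. 10; M. Kontsevich, D. Zagier, *Periods* (2001), §1.2 rules (2)–(3);
S. Basu, R. Pollack, M.-F. Roy, *Algorithms in Real Algebraic Geometry* (2006), Prop. 3.22.
-/

noncomputable section

namespace Summit.KontsevichZagierPeriods.FurushoPentagon.ReducedPeriodRing.LinStokesSym

open Set MeasureTheory
open Literature.NumberTheory.Transcendental
open Literature.NumberTheory.Transcendental.KZ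
open Summit.KontsevichZagierPeriods.FurushoPentagon.SectorToKernel

/-- The first component `K(x, y) = (y − 1)·g(x with xⱼ ↦ xⱼ(1 − y))` of the reflection 1-form on
`ℝⁿ⁺¹ ∋ (x, y)` (file-local notation): `K|_{y=1} − K|_{y=0} = g`. -/
local notation3 (prettyPrint := false) "K[" n ", " g ", " j "]" => fun w : Fin (n + 1) → ℝ =>
  (w (Fin.last n) - 1) *
    g (Function.update (Fin.init w) j (w (Fin.castSucc j) * (1 - w (Fin.last n))))

/-- The second component `L(x, y) = xⱼ·g(x with xⱼ ↦ xⱼ(1 − y))` of the reflection 1-form on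
`ℝⁿ⁺¹ ∋ (x, y)` (file-local notation): `∂ⱼL = ∂_yK`,
`L|_{xⱼ=1} − L|_{xⱼ=0} = g(x with xⱼ ↦ 1 − y)`. -/
local notation3 (prettyPrint := false) "L[" n ", " g ", " j "]" => fun w : Fin (n + 1) → ℝ =>
  w (Fin.castSucc j) *
    g (Function.update (Fin.init w) j (w (Fin.castSucc j) * (1 - w (Fin.last n))))

namespace ReflectionGeneration

open SubdivGeneration (analyticOnNhd_apply isTameCube_reindex analyticOnNhd_comp_perm
  isSemialgebraicFunOn_comp_perm comp_swap_snoc hasDerivAt_update_slice)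

variable {n : ℕ} {g : (Fin n → ℝ) → ℝ} {j : Fin n} {K L : (Fin (n + 1) → ℝ) → ℝ}

/-- `K` on a slice `s ↦ (x, s)`. [folklore] -/
theorem fstForm_snoc (hK : K = K[n, g, j]) (x : Fin n → ℝ) (s : ℝ) :
    K (Fin.snoc x s) = (s - 1) * g (Function.update x j (x j * (1 - s))) := by
  simp [hK, Fin.init_snoc, Fin.snoc_last, Fin.snoc_castSucc]

/-- `L` on a slice `s ↦ (x, s)`. [folklore] -/
theorem sndForm_snoc (hL : L = L[n, g, j]) (x : Fin n → ℝ) (s : ℝ) :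
    L (Fin.snoc x s) = x j * g (Function.update x j (x j * (1 - s))) := by
  simp [hL, Fin.init_snoc, Fin.snoc_last, Fin.snoc_castSucc]

/-- `L` on a transposed slice `a ↦ ((y with yⱼ ↦ a), s)`. [folklore] -/
theorem sndForm_snoc_update (hL : L = L[n, g, j]) (y : Fin n → ℝ) (a s : ℝ) :
    L (Fin.snoc (Function.update y j a) s) = a * g (Function.update y j (a * (1 - s))) := by
  rw [sndForm_snoc hL]
  simp [Function.update_idem]

/-- Arguments of the contraction `xⱼ ↦ t(1 − s)` stay in the cube. [folklore] -/
theorem update_mul_mem_cube {y : Fin n → ℝ} (hy : y ∈ cube n) (j : Fin n) {s t : ℝ}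
    (hs : s ∈ Icc (0 : ℝ) 1) (ht : t ∈ Icc (0 : ℝ) 1) :
    Function.update y j (t * (1 - s)) ∈ cube n :=
  update_mem_cube hy j (mul_nonneg ht.1 (by linarith [hs.2]))
    (by nlinarith [hs.1, hs.2, ht.1, ht.2])

/-- **Side conditions.** For `g` analytic near `[0,1]ⁿ` and `ℚ`-semialgebraic on it, `K` and `L`
are analytic near `[0,1]ⁿ⁺¹` and `ℚ`-semialgebraic on it: compositions of `g` with the polynomial
map `(x, y) ↦ (x with xⱼ ↦ xⱼ(1 − y))` over `ℚ` sending the cube into the cube, times polynomials.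
[Bochnak–Coste–Roy 1998, Prop. 2.2.6] -/
theorem sideConditions (hga : AnalyticOnNhd ℝ g (cube n)) (hgs : IsSemialgebraicFunOn ℚ (cube n) g)
    (hK : K = K[n, g, j]) (hL : L = L[n, g, j]) :
    (AnalyticOnNhd ℝ K (cube (n + 1)) ∧ IsSemialgebraicFunOn ℚ (cube (n + 1)) K) ∧
      (AnalyticOnNhd ℝ L (cube (n + 1)) ∧ IsSemialgebraicFunOn ℚ (cube (n + 1)) L) := by
  have hX : ∀ k : Fin (n + 1), AnalyticOnNhd ℝ (fun w : Fin (n + 1) → ℝ => w k) (cube (n + 1)) :=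
    fun k => analyticOnNhd_apply _ k _
  have hXs : ∀ k : Fin (n + 1),
      IsSemialgebraicFunOn ℚ (cube (n + 1)) (fun w : Fin (n + 1) → ℝ => w k) :=
    fun k => isSemialgebraicFunOn_apply isSemialgebraic_cube k
  have h1s : IsSemialgebraicFunOn ℚ (cube (n + 1)) (fun _ : Fin (n + 1) → ℝ => (1 : ℝ)) := by
    simpa using isSemialgebraicFunOn_ratCast (isSemialgebraic_cube (n := n + 1)) 1
  -- the contracted coordinate `p = u(1 − y)`
  have hpa : AnalyticOnNhd ℝ
      (fun w : Fin (n + 1) → ℝ => w (Fin.castSucc j) * (1 - w (Fin.last n))) (cube (n + 1)) :=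
    (hX _).mul (analyticOnNhd_const.sub (hX _))
  have hps : IsSemialgebraicFunOn ℚ (cube (n + 1))
      (fun w : Fin (n + 1) → ℝ => w (Fin.castSucc j) * (1 - w (Fin.last n))) :=
    (hXs _).fun_mul (h1s.fun_sub (hXs _))
  have hmaps : MapsTo (fun w : Fin (n + 1) → ℝ =>
      Function.update (Fin.init w) j (w (Fin.castSucc j) * (1 - w (Fin.last n))))
      (cube (n + 1)) (cube n) := fun w hw =>
    update_mem_cube (fun k => hw (Fin.castSucc k)) j
      (mul_nonneg (hw _).1 (by linarith [(hw (Fin.last n)).2]))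
      (by nlinarith [(hw (Fin.last n)).1, (hw (Fin.last n)).2, (hw (Fin.castSucc j)).1,
        (hw (Fin.castSucc j)).2])
  -- the composition `g ∘ (x with xⱼ ↦ p)`
  have hGa : AnalyticOnNhd ℝ (fun w : Fin (n + 1) → ℝ =>
      g (Function.update (Fin.init w) j (w (Fin.castSucc j) * (1 - w (Fin.last n)))))
      (cube (n + 1)) := by
    refine hga.comp (AnalyticOnNhd.pi fun k => ?_) hmaps
    rcases eq_or_ne k j with rfl | hk
    · simpa only [Function.update_self] using hpa
    · simp only [Function.update_of_ne hk]; exact hX (Fin.castSucc k)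
  have hGs : IsSemialgebraicFunOn ℚ (cube (n + 1)) (fun w : Fin (n + 1) → ℝ =>
      g (Function.update (Fin.init w) j (w (Fin.castSucc j) * (1 - w (Fin.last n))))) := by
    refine IsSemialgebraicFunOn.comp_isSemialgebraicMapOn_holds hgs
      (IsSemialgebraicMapOn.of_forall isSemialgebraic_cube fun k => ?_) hmaps
    rcases eq_or_ne k j with rfl | hk
    · simpa only [Function.update_self] using hps
    · simp only [Function.update_of_ne hk]; exact hXs (Fin.castSucc k)
  subst hK hL
  exact ⟨⟨((hX _).sub analyticOnNhd_const).mul hGa, ((hXs _).fun_sub h1s).fun_mul hGs⟩,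
    (hX _).mul hGa, (hXs _).fun_mul hGs⟩

/-! ### The calculus identity `∂_y K = ∂ⱼ L` -/

/-- **The calculus identity `∂_y K = ∂ⱼ L`, transposed.** For `y ∈ [0,1]ⁿ` and `t ∈ [0,1]` the
slice `a ↦ L((y with yⱼ ↦ a), yⱼ)` has derivative at `a = t` the last partial derivative of `K` at
the transposed point `((y with yⱼ ↦ t), yⱼ)`. With `s = yⱼ`, `h(a) = g(y with yⱼ ↦ a)` and
`A = t(1 − s)`, both equal `h(A) + t(1 − s)·h′(A)` (product and chain rules; the value of `∂_y K`
by uniqueness of derivatives). [folklore] -/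
theorem hasDerivAt_sndForm_swap (hg : AnalyticOnNhd ℝ g (cube n)) (hK : K = K[n, g, j])
    (hL : L = L[n, g, j]) (hKa : AnalyticOnNhd ℝ K (cube (n + 1))) {y : Fin n → ℝ}
    (hy : y ∈ cube n) {t : ℝ} (ht : t ∈ Icc (0 : ℝ) 1) :
    HasDerivAt (fun a : ℝ => L (Fin.snoc (Function.update y j a) (y j)))
      (fderiv ℝ K (Fin.snoc (Function.update y j t) (y j)) (Pi.single (Fin.last n) 1)) t := by
  have hs : y j ∈ Icc (0 : ℝ) 1 := ⟨(hy j).1, (hy j).2⟩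
  have hd : DifferentiableAt ℝ g (Function.update y j (t * (1 - y j))) :=
    (hg _ (update_mul_mem_cube hy j hs ht)).differentiableAt
  -- `∂_y K` at the transposed point `(x, s) = ((y with yⱼ ↦ t), yⱼ)`, `s = yⱼ`
  set x : Fin n → ℝ := Function.update y j t with hx_def
  have hxj : x j = t := by simp [hx_def]
  have hupd : ∀ c : ℝ, Function.update x j c = Function.update y j c := fun c => by
    simp [hx_def, Function.update_idem]
  have hw : (Fin.snoc x (y j) : Fin (n + 1) → ℝ) ∈ cube (n + 1) :=
    snoc_mem_cube_iff.2 ⟨update_mem_cube hy j ht.1 ht.2, hs.1, hs.2⟩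
  have hin : HasDerivAt (fun σ : ℝ => t * (1 - σ)) (t * -1) (y j) :=
    ((hasDerivAt_id' (y j)).const_sub 1).const_mul t
  have hgK : HasDerivAt (fun σ : ℝ => g (Function.update y j (t * (1 - σ))))
      (fderiv ℝ g (Function.update y j (t * (1 - y j))) (Pi.single j 1) * (t * -1)) (y j) :=
    ((hasDerivAt_update_slice hd).comp (y j) hin :)
  have hK' := ((hasDerivAt_id' (y j)).sub_const (1 : ℝ)).fun_mul hgK
  have hKx := stokesCal_hasDerivAt_snoc ((hKa _ hw).differentiableAt)
  have hfunK : (fun σ : ℝ => K (Fin.snoc x σ)) = fun σ =>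
      (σ - 1) * g (Function.update y j (t * (1 - σ))) :=
    funext fun σ => by simp only [fstForm_snoc hK, hxj, hupd]
  rw [hfunK] at hKx
  rw [hKx.unique hK']
  -- `∂ⱼ L` on the slice `a ↦ ((y with yⱼ ↦ a), s)`
  have hfun : (fun a : ℝ => L (Fin.snoc (Function.update y j a) (y j))) =
      fun a => a * g (Function.update y j (a * (1 - y j))) :=
    funext fun a => sndForm_snoc_update hL y a (y j)
  rw [hfun]
  have hb : HasDerivAt (fun a : ℝ => a * (1 - y j)) (1 * (1 - y j)) t :=
    (hasDerivAt_id' t).mul_const (1 - y j)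
  have hgL : HasDerivAt (fun a : ℝ => g (Function.update y j (a * (1 - y j))))
      (fderiv ℝ g (Function.update y j (t * (1 - y j))) (Pi.single j 1) * (1 * (1 - y j))) t :=
    ((hasDerivAt_update_slice hd).comp t hb :)
  exact ((hasDerivAt_id' t).fun_mul hgL).congr_deriv (by ring)

/-- **Coordinate reflections from StokesLast + Sym.** For tame cubes `r, r'` with
`r.integrand x = r'.integrand (x with xⱼ ↦ 1 − xⱼ)` on the cube, `[r] − [r'] ∈ linStokesSymIdeal`:
with `g = r'.integrand`, `R = [[0,1]ⁿ⁺¹, ∂_y K]` and `τ = (j last)` it is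
`([R] − [r']) − ([R] − [R.reindex τ]) − ([R.reindex τ] − [r])` (StokesLast with primitive `K`, Sym,
StokesLast with primitive `L ∘ τ`).
[Ayoub 2014, Def. 10; Kontsevich–Zagier 2001, §1.2 rules (2)–(3)] -/
theorem of_sub_of_mem {r r' : IntegralRep n} (j : Fin n) (hr : r.IsTameCube)
    (hr' : r'.IsTameCube)
    (hrefl : ∀ x ∈ cube n, r.integrand x = r'.integrand (Function.update x j (1 - x j))) :
    of r - of r' ∈ linStokesSymIdeal := by
  obtain ⟨K, hK⟩ : ∃ K : (Fin (n + 1) → ℝ) → ℝ, K = K[n, r'.integrand, j] := ⟨_, rfl⟩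
  obtain ⟨L, hL⟩ : ∃ L : (Fin (n + 1) → ℝ) → ℝ, L = L[n, r'.integrand, j] := ⟨_, rfl⟩
  obtain ⟨⟨hKa, hKs⟩, hLa, hLs⟩ := sideConditions hr'.2 hr'.isSemialgebraicFunOn hK hL
  -- `R = [[0,1]ⁿ⁺¹, ∂_y K]`, `τ = (j last)`
  have hK'a := stokesCal_analyticOnNhd_fderiv_apply hKa (Pi.single (Fin.last n) 1)
  obtain ⟨R, hRd, hRi⟩ : ∃ R : IntegralRep (n + 1), R.domain = cube (n + 1) ∧ R.integrand =
      fun w => fderiv ℝ K w (Pi.single (Fin.last n) 1) :=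
    ⟨IntegralRep.tameCube _ hK'a (stokesCal_isSemialgebraicFunOn_fderiv_last hKa hKs), rfl, rfl⟩
  have hRt : R.IsTameCube := ⟨hRd, by rw [hRi]; exact hK'a⟩
  obtain ⟨τ, hτ⟩ : ∃ τ : Equiv.Perm (Fin (n + 1)), τ = Equiv.swap (Fin.castSucc j) (Fin.last n) :=
    ⟨_, rfl⟩
  -- StokesLast with primitive `K`: `[R] − [r']`
  have hA : of R - of r' ∈ linStokesSymIdeal := by
    refine cubicalStokesGens_subset_linStokesSymIdeal (mem_cubicalStokesGens hRt hr' hKa hKs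
      (fun x hx t ht => ?_) fun x _ => ?_)
    · rw [hRi]
      exact stokesCal_hasDerivAt_snoc
        (hKa _ (snoc_mem_cube_iff.2 ⟨hx, ht.1, ht.2⟩)).differentiableAt
    · simp only [fstForm_snoc hK, sub_self, zero_mul, sub_zero, mul_one,
        Function.update_eq_self]
      ring
  -- Sym: `[R] − [R.reindex τ]`
  have hS := of_sub_of_reindex_mem_linStokesSymIdeal hRt τ
  -- StokesLast with primitive `L ∘ τ`: `[R.reindex τ] − [r]`
  have hB : of (R.reindex τ) - of r ∈ linStokesSymIdeal := by
    refine cubicalStokesGens_subset_linStokesSymIdeal (mem_cubicalStokesGens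
      (F := fun w : Fin (n + 1) → ℝ => L (fun k => w (τ k)))
      (isTameCube_reindex hRt τ) hr (analyticOnNhd_comp_perm hLa τ)
      (isSemialgebraicFunOn_comp_perm hLs τ) (fun y hy t ht => ?_) fun y hy => ?_)
    · have hfun : (fun s : ℝ => L (fun k => (Fin.snoc y s : Fin (n + 1) → ℝ) (τ k))) =
          fun s => L (Fin.snoc (Function.update y j s) (y j)) :=
        funext fun s => by rw [hτ, comp_swap_snoc]
      rw [hfun, IntegralRep.reindex_integrand, hRi]
      simp only
      rw [hτ, comp_swap_snoc]
      exact hasDerivAt_sndForm_swap hr'.2 hK hL hKa hy ht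
    · rw [hτ, comp_swap_snoc, comp_swap_snoc, sndForm_snoc_update hL, sndForm_snoc_update hL,
        hrefl y hy]
      simp only [one_mul, zero_mul, sub_zero]
  rw [show of r - of r' = (of R - of r') - (of R - of (R.reindex τ)) - (of (R.reindex τ) - of r) by
    abel]
  exact linStokesSymIdeal.sub_mem (linStokesSymIdeal.sub_mem hA hS) hB

end ReflectionGeneration

/-- **Stub `stub_reflectionGeneration`** (crux stmt-KontsevichZagierPeriods-3929, line
`lin-stokes-sym`): the reflection `xⱼ ↦ 1 − xⱼ` of a tame cube lies in Ayoub's relation module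
with symmetries `linStokesSymIdeal = closure (Lin ∪ StokesLast ∪ Sym)`: if
`r.integrand x = r'.integrand (x with xⱼ ↦ 1 − xⱼ)` on `[0,1]ⁿ` then
`[r] − [r'] ∈ linStokesSymIdeal` (`ReflectionGeneration.of_sub_of_mem`, a two-coordinate Stokes
identity).
[Ayoub 2014, Def. 10; Kontsevich–Zagier 2001, §1.2 rules (2)–(3)] -/
theorem stub_reflectionGeneration : ∀ (n : ℕ) (r r' : IntegralRep n) (j : Fin n), r.domain = cube n → AnalyticOnNhd ℝ r.integrand (cube n) → r'.domain = cube n → AnalyticOnNhd ℝ r'.integrand (cube n) → (∀ x ∈ cube n, r.integrand x = r'.integrand (Function.update x j (1 - x j))) → of r - of r' ∈ linStokesSymIdeal :=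
  fun _ _ _ j hr hra hr' hr'a hrefl =>
    ReflectionGeneration.of_sub_of_mem j ⟨hr, hra⟩ ⟨hr', hr'a⟩ hrefl

end Summit.KontsevichZagierPeriods.FurushoPentagon.ReducedPeriodRing.LinStokesSym
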